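import Summits.CriticalPhenomena.Ising3DConformalLimit.Theses.SynchronousCoupling
import Literature.Probability.LatticeModels.GibbsSpecification
import HarnessLib

/-!
# A necessary condition of the crux `DilationJoinings` (stmt-CriticalPhenomena-18762):
# power-rate Cauchy property of the block-variance ratios

Route `SynchronousCoupling`, sub-problem `CriticalPhenomena/Ising3DConformalLimit`, line `Sketch` (lead's
file; registered helper `dj_necessary_ratioCauchy`, `--supports stmt-CriticalPhenomena-18762`).

Let `A_ℓ² := ∫ (∑_{x ∈ [0,ℓ)³} σ_x)² dμ` be the block second moment of a critical DLR state `μ` of the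
n.n. Ising model on `ℤ³`.  **If `DilationJoinings` holds then for `p ∈ {2,3}` there are `C, θ > 0` with
`(A_{p²b}/A_{pb} − A_{pb}/A_b)² ≤ C b^(−θ)` for all `b ≥ 1`** — the ratio sequence `A_{pb}/A_b` is Cauchy
with a geometric rate along every tower `b p^j` ("`η` exists along `p^j`, with a rate"; refuter
rattack-18762-0, necessary condition (ii)).  This is an in-law, two-point-function-only consequence of the
crux, recorded so that a refutation of the crux can be routed through `⟨σσ⟩_{β_c}` alone.

Proof.  Take the crux's coupling `π` at scale `b` with window `m = p`.  For the `p³` window positions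
`u ∈ [0,p)³` the defect vectors `f_u = Ŝ¹_{pb}(pbu) − Ŝ²_b(bu)` have `‖f_u‖²_{L²(π)} ≤ C b^(−θ)`; their sum is
`S¹_{p²b}(0)/A_{pb} − S²_{pb}(0)/A_b` because a box of side `pL` is the disjoint union of the `p³` boxes of
side `L` at the corners `L u` (`sum_subBoxes`), so by Cauchy–Schwarz over the `p³` summands its squared norm
is `≤ p⁶ C b^(−θ)`; finally `(‖U‖ − ‖V‖)² ≤ ‖U − V‖²` (Cauchy–Schwarz, `sq_sqrt_sub_sqrt_le`) and the
marginal identities `‖S¹_{p²b}(0)‖_{L²(π)} = A_{p²b}`, `‖S²_{pb}(0)‖_{L²(π)} = A_{pb}` give the claim with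
constant `p⁶ C`.
-/

noncomputable section

namespace Summit.CriticalPhenomena.Ising3DConformalLimit.Cruxes.DilationJoinings.Sketch

open MeasureTheory Literature.Probability.LatticeModels
open Summit.CriticalPhenomena.Ising3DConformalLimit.Theses.SynchronousCoupling (DilationJoinings)

/-! ## Box decomposition -/

/-- The box `[0, pL)³` is the union over `u ∈ [0,p)³` of the boxes `Π_i [L u_i, L u_i + L)` (`L > 0`). -/
theorem bigBox_eq_biUnion {L : ℤ} (hL : 0 < L) (p : ℕ) :
    Fintype.piFinset (fun _ : Fin 3 => Finset.Ico (0:ℤ) ((p:ℤ) * L)) =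
      (Fintype.piFinset (fun _ : Fin 3 => Finset.Ico (0:ℤ) (p:ℤ))).biUnion
        (fun u => Fintype.piFinset (fun i : Fin 3 => Finset.Ico (L * u i) (L * u i + L))) := by
  ext x
  simp only [Finset.mem_biUnion, Fintype.mem_piFinset, Finset.mem_Ico]
  constructor
  · intro hx
    refine ⟨fun i => x i / L, fun i => ⟨Int.ediv_nonneg (hx i).1 hL.le, ?_⟩, fun i => ?_⟩
    · exact Int.ediv_lt_of_lt_mul hL (by linarith [(hx i).2])
    · have h1 := Int.emod_add_mul_ediv (x i) L
      have h2 := Int.emod_nonneg (x i) hL.ne'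
      have h3 := Int.emod_lt_of_pos (x i) hL
      constructor <;> linarith
  · rintro ⟨u, hu, hxu⟩ i
    obtain ⟨h1, h2⟩ := hxu i
    obtain ⟨h3, h4⟩ := hu i
    constructor
    · nlinarith [mul_nonneg hL.le h3]
    · have h5 : u i + 1 ≤ (p:ℤ) := h4
      nlinarith [mul_le_mul_of_nonneg_left h5 hL.le]

/-- The sub-boxes `Π_i [L u_i, L u_i + L)`, `u ∈ [0,p)³`, are pairwise disjoint (`L > 0`). -/
theorem subBoxes_pairwiseDisjoint {L : ℤ} (hL : 0 < L) (p : ℕ) :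
    Set.PairwiseDisjoint
      ((Fintype.piFinset (fun _ : Fin 3 => Finset.Ico (0:ℤ) (p:ℤ)) : Finset (Fin 3 → ℤ)) : Set (Fin 3 → ℤ))
      (fun u : Fin 3 → ℤ => Fintype.piFinset (fun i : Fin 3 => Finset.Ico (L * u i) (L * u i + L))) := by
  intro u _ v _ huv
  rw [Function.onFun, Finset.disjoint_left]
  intro x hxu hxv
  apply huv
  funext i
  simp only [Fintype.mem_piFinset, Finset.mem_Ico] at hxu hxv
  obtain ⟨h1, h2⟩ := hxu i
  obtain ⟨h3, h4⟩ := hxv i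
  have h5 : L * u i < L * (v i + 1) := by linarith
  have h6 : L * v i < L * (u i + 1) := by linarith
  have h7 := lt_of_mul_lt_mul_left h5 hL.le
  have h8 := lt_of_mul_lt_mul_left h6 hL.le
  omega

/-- **Block additivity**: summing a function over the `p³` sub-boxes of side `L` at the corners `L u`,
`u ∈ [0,p)³`, is summing it over the box `[0, pL)³` (`L > 0`). -/
theorem sum_subBoxes {L : ℤ} (hL : 0 < L) (p : ℕ) (g : Site 3 → ℝ) :
    ∑ u ∈ Fintype.piFinset (fun _ : Fin 3 => Finset.Ico (0:ℤ) (p:ℤ)),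
        ∑ x ∈ Fintype.piFinset (fun i : Fin 3 => Finset.Ico (L * u i) (L * u i + L)), g x =
      ∑ x ∈ Fintype.piFinset (fun _ : Fin 3 => Finset.Ico (0:ℤ) ((p:ℤ) * L)), g x := by
  rw [bigBox_eq_biUnion hL p, Finset.sum_biUnion (subBoxes_pairwiseDisjoint hL p)]

/-! ## Two Cauchy–Schwarz inequalities -/

/-- `(√∫U² − √∫V²)² ≤ ∫ (U − V)²` for square-integrable real `U`, `V` with `U V` integrable
(Cauchy–Schwarz `∫ U V ≤ √∫U² √∫V²`, via the discriminant of `t ↦ ∫ (tU − V)²`). -/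
theorem sq_sqrt_sub_sqrt_le {Ω : Type*} [MeasurableSpace Ω] {π : Measure Ω} {U V : Ω → ℝ}
    (hU2 : Integrable (fun ω => U ω ^ 2) π) (hV2 : Integrable (fun ω => V ω ^ 2) π)
    (hUV : Integrable (fun ω => U ω * V ω) π) :
    (Real.sqrt (∫ ω, U ω ^ 2 ∂π) - Real.sqrt (∫ ω, V ω ^ 2 ∂π)) ^ 2 ≤ ∫ ω, (U ω - V ω) ^ 2 ∂π := by
  set a := ∫ ω, U ω ^ 2 ∂π with ha_def
  set c := ∫ ω, V ω ^ 2 ∂π with hc_def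
  set m := ∫ ω, U ω * V ω ∂π with hm_def
  have ha : 0 ≤ a := integral_nonneg fun ω => sq_nonneg _
  have hc : 0 ≤ c := integral_nonneg fun ω => sq_nonneg _
  have hexp : ∀ t : ℝ, ∫ ω, (t * U ω - V ω) ^ 2 ∂π = a * (t * t) + (-(2 * m)) * t + c := by
    intro t
    have h : (fun ω => (t * U ω - V ω) ^ 2) =
        fun ω => (t ^ 2 * U ω ^ 2 - 2 * t * (U ω * V ω)) + V ω ^ 2 := by
      funext ω; ring
    have h1 : Integrable (fun ω => t ^ 2 * U ω ^ 2) π := hU2.const_mul _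
    have h2 : Integrable (fun ω => 2 * t * (U ω * V ω)) π := hUV.const_mul _
    have h12 : Integrable (fun ω => t ^ 2 * U ω ^ 2 - 2 * t * (U ω * V ω)) π := h1.sub h2
    rw [h, integral_add h12 hV2, integral_sub h1 h2, integral_const_mul, integral_const_mul]
    ring
  have hdisc : discrim a (-(2 * m)) c ≤ 0 :=
    discrim_le_zero fun t => by rw [← hexp t]; exact integral_nonneg fun ω => sq_nonneg _
  have hm2 : m ^ 2 ≤ a * c := by
    have : (-(2 * m)) ^ 2 - 4 * a * c ≤ 0 := hdisc
    nlinarith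
  have hm : m ≤ Real.sqrt a * Real.sqrt c := by
    rw [← Real.sqrt_mul ha]
    calc m ≤ |m| := le_abs_self m
      _ = Real.sqrt (m ^ 2) := (Real.sqrt_sq_eq_abs m).symm
      _ ≤ Real.sqrt (a * c) := Real.sqrt_le_sqrt hm2
  have h1 := hexp 1
  simp only [one_mul, mul_one] at h1
  rw [h1, sub_sq, Real.sq_sqrt ha, Real.sq_sqrt hc]
  nlinarith

/-- A measurable real function bounded in absolute value is integrable against a finite measure. -/
theorem integrable_of_abs_le' {Ω : Type*} [MeasurableSpace Ω] {π : Measure Ω}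
    [IsFiniteMeasure π] {f : Ω → ℝ} (hf : Measurable f) (C : ℝ) (hC : ∀ ω, |f ω| ≤ C) :
    Integrable f π :=
  Integrable.of_bound hf.aestronglyMeasurable C
    (ae_of_all _ fun ω => by rw [Real.norm_eq_abs]; exact hC ω)

/-- Cauchy–Schwarz over a finite index set, integrated: `∫ (∑_{u ∈ T} f_u)² ≤ |T| ∑_{u ∈ T} ∫ f_u²` for
bounded measurable `f_u` on a finite measure space. -/
theorem integral_sq_sum_le' {Ω ι : Type*} [MeasurableSpace Ω] {π : Measure Ω} [IsFiniteMeasure π]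
    (T : Finset ι) (f : ι → Ω → ℝ) (hf : ∀ u, Measurable (f u)) (B : ℝ) (hB : ∀ u ω, |f u ω| ≤ B) :
    ∫ ω, (∑ u ∈ T, f u ω) ^ 2 ∂π ≤ T.card * ∑ u ∈ T, ∫ ω, f u ω ^ 2 ∂π := by
  have hpt : ∀ ω, (∑ u ∈ T, f u ω) ^ 2 ≤ T.card * ∑ u ∈ T, f u ω ^ 2 := fun ω => by
    have := Finset.sum_mul_sq_le_sq_mul_sq T (fun u => f u ω) (fun _ => (1 : ℝ))
    simp only [mul_one, one_pow, Finset.sum_const, nsmul_eq_mul] at this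
    linarith
  have hint : ∀ u ∈ T, Integrable (fun ω => f u ω ^ 2) π := fun u _ =>
    integrable_of_abs_le' ((hf u).pow_const 2) (B ^ 2) fun ω => by
      rw [abs_pow]; exact pow_le_pow_left₀ (abs_nonneg _) (hB u ω) 2
  calc ∫ ω, (∑ u ∈ T, f u ω) ^ 2 ∂π
      ≤ ∫ ω, T.card * ∑ u ∈ T, f u ω ^ 2 ∂π :=
        integral_mono_of_nonneg (ae_of_all _ fun ω => sq_nonneg _)
          ((integrable_finsetSum _ hint).const_mul _) (ae_of_all _ hpt)
    _ = T.card * ∑ u ∈ T, ∫ ω, f u ω ^ 2 ∂π := by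
        rw [integral_const_mul, integral_finsetSum _ hint]

/-! ## The necessary condition -/

/-- **`DilationJoinings` forces the block-variance ratios to be power-Cauchy** (registered helper
`dj_necessary_ratioCauchy` of stmt-CriticalPhenomena-18762): if the crux holds then for every critical DLR
state `μ` (translation invariant) and `p ∈ {2,3}` there are `C, θ > 0` with
`(A_{p²b}/A_{pb} − A_{pb}/A_b)² ≤ C b^(−θ)` for all `b ≥ 1`, `A_ℓ = √∫ (∑_{x∈[0,ℓ)³} σ_x)² dμ`
(sum the crux's `p³` window defects at scale `b`; Cauchy–Schwarz twice). -/
theorem dj_necessary_ratioCauchy :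
    DilationJoinings → ∀ μ ∈ isingGibbsMeasures 3 (criticalBeta 3) 0, IsTranslationInvariantMeasure μ →
      ∀ p : ℕ, (p = 2 ∨ p = 3) → ∃ C θ : ℝ, 0 < θ ∧ ∀ b : ℕ, 1 ≤ b →
        (Real.sqrt (∫ σ, (∑ x ∈ Fintype.piFinset (fun _ : Fin 3 => Finset.Ico (0:ℤ) ((p:ℤ) * ((p:ℤ) * b))), spinAt x σ) ^ 2 ∂μ)
            / Real.sqrt (∫ σ, (∑ x ∈ Fintype.piFinset (fun _ : Fin 3 => Finset.Ico (0:ℤ) ((p:ℤ) * b)), spinAt x σ) ^ 2 ∂μ)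
          - Real.sqrt (∫ σ, (∑ x ∈ Fintype.piFinset (fun _ : Fin 3 => Finset.Ico (0:ℤ) ((p:ℤ) * b)), spinAt x σ) ^ 2 ∂μ)
            / Real.sqrt (∫ σ, (∑ x ∈ Fintype.piFinset (fun _ : Fin 3 => Finset.Ico (0:ℤ) ((b:ℤ))), spinAt x σ) ^ 2 ∂μ)) ^ 2
          ≤ C * (b : ℝ) ^ (-θ) := by
  intro hDJ μ hμ hTI p hp
  obtain ⟨C, θ, hθ, H⟩ := hDJ μ hμ hTI p hp
  refine ⟨(p : ℝ) ^ 6 * C, θ, hθ, fun b hb => ?_⟩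
  obtain ⟨π, hfst, hsnd, hwin⟩ := H b p hb
  haveI : IsProbabilityMeasure μ :=
    ((mem_isingGibbsMeasures_iff _ _ _ _).1 hμ).isProbabilityMeasure
  haveI : IsProbabilityMeasure π :=
    ⟨by rw [← Measure.fst_univ, hfst]; exact measure_univ⟩
  -- notation
  set Apb : ℝ := ∫ σ, (∑ x ∈ Fintype.piFinset (fun _ : Fin 3 => Finset.Ico (0:ℤ) ((p:ℤ) * b)),
    spinAt x σ) ^ 2 ∂μ with hApb
  set Ab : ℝ := ∫ σ, (∑ x ∈ Fintype.piFinset (fun _ : Fin 3 => Finset.Ico (0:ℤ) ((b:ℤ))),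
    spinAt x σ) ^ 2 ∂μ with hAb
  set α : ℝ := (Real.sqrt Apb)⁻¹ with hα
  set β : ℝ := (Real.sqrt Ab)⁻¹ with hβ
  have hα0 : 0 ≤ α := inv_nonneg.2 (Real.sqrt_nonneg _)
  have hβ0 : 0 ≤ β := inv_nonneg.2 (Real.sqrt_nonneg _)
  -- the window positions and the defect vectors
  set T : Finset (Fin 3 → ℤ) := Fintype.piFinset (fun _ : Fin 3 => Finset.Ico (0:ℤ) (p:ℤ)) with hT
  set f : (Fin 3 → ℤ) → SpinConfig (Site 3) × SpinConfig (Site 3) → ℝ := fun u q =>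
    α * (∑ x ∈ Fintype.piFinset (fun i : Fin 3 =>
        Finset.Ico ((p:ℤ) * b * u i) ((p:ℤ) * b * u i + (p:ℤ) * b)), spinAt x q.1)
      - β * (∑ x ∈ Fintype.piFinset (fun i : Fin 3 =>
        Finset.Ico ((b:ℤ) * u i) ((b:ℤ) * u i + (b:ℤ))), spinAt x q.2) with hf
  have hbd : ∀ (S : Finset (Site 3)) (σ : SpinConfig (Site 3)),
      |∑ x ∈ S, spinAt x σ| ≤ (S.card : ℝ) := by
    intro S σ
    calc |∑ x ∈ S, spinAt x σ| ≤ ∑ x ∈ S, |spinAt x σ| := Finset.abs_sum_le_sum_abs _ _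
      _ = (S.card : ℝ) := by simp [abs_spinAt]
  have hmeasS : ∀ S : Finset (Site 3), Measurable fun σ : SpinConfig (Site 3) => ∑ x ∈ S, spinAt x σ :=
    fun S => Finset.measurable_sum S fun x _ => measurable_spinAt x
  -- each defect vector is small (the crux's window bound at `m = p`)
  have hwin' : ∀ u ∈ T, ∫ q, f u q ^ 2 ∂π ≤ C * (b : ℝ) ^ (-θ) := by
    intro u hu
    have hu' : ∀ i, |u i| ≤ (p : ℤ) := by
      intro i
      have := (Fintype.mem_piFinset.1 hu) i
      rw [Finset.mem_Ico] at this
      rw [abs_le]; constructor <;> linarith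
    exact hwin u hu'
  -- measurability and a uniform bound for the defect vectors
  have hfm : ∀ u, Measurable (f u) := fun u =>
    (((hmeasS _).comp measurable_fst).const_mul α).sub (((hmeasS _).comp measurable_snd).const_mul β)
  set B : ℝ := α * ((p:ℝ) * b) ^ 3 + β * ((b:ℝ)) ^ 3 with hB
  have hcardbox : ∀ (L : ℤ) (c : Fin 3 → ℤ), 0 ≤ L →
      ((Fintype.piFinset (fun i : Fin 3 => Finset.Ico (c i) (c i + L))).card : ℝ) = (L : ℝ) ^ 3 := by
    intro L c hL
    rw [Fintype.card_piFinset]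
    simp only [Int.card_Ico, add_sub_cancel_left, Finset.prod_const, Finset.card_univ,
      Fintype.card_fin, Nat.cast_pow]
    rw [show ((L.toNat : ℕ) : ℝ) = ((L.toNat : ℤ) : ℝ) by norm_cast, Int.toNat_of_nonneg hL]
  have hfb : ∀ u q, |f u q| ≤ B := by
    intro u q
    have h1 := hbd (Fintype.piFinset (fun i : Fin 3 =>
        Finset.Ico ((p:ℤ) * b * u i) ((p:ℤ) * b * u i + (p:ℤ) * b))) q.1
    have h2 := hbd (Fintype.piFinset (fun i : Fin 3 =>
        Finset.Ico ((b:ℤ) * u i) ((b:ℤ) * u i + (b:ℤ)))) q.2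
    rw [hcardbox ((p:ℤ) * b) (fun i => (p:ℤ) * b * u i) (by positivity)] at h1
    rw [hcardbox (b:ℤ) (fun i => (b:ℤ) * u i) (by positivity)] at h2
    push_cast at h1 h2
    calc |f u q| ≤ |α * ∑ x ∈ Fintype.piFinset (fun i : Fin 3 =>
            Finset.Ico ((p:ℤ) * b * u i) ((p:ℤ) * b * u i + (p:ℤ) * b)), spinAt x q.1|
          + |β * ∑ x ∈ Fintype.piFinset (fun i : Fin 3 =>
            Finset.Ico ((b:ℤ) * u i) ((b:ℤ) * u i + (b:ℤ))), spinAt x q.2| := abs_sub _ _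
      _ ≤ α * ((p:ℝ) * b) ^ 3 + β * ((b:ℝ)) ^ 3 := by
          rw [abs_mul, abs_mul, abs_of_nonneg hα0, abs_of_nonneg hβ0]
          exact add_le_add (mul_le_mul_of_nonneg_left h1 hα0) (mul_le_mul_of_nonneg_left h2 hβ0)
  -- the sum of the defect vectors is the big-block difference
  have hp0 : (0:ℤ) < (p:ℤ) := by rcases hp with rfl | rfl <;> norm_num
  have hb0 : (0:ℤ) < (b:ℤ) := by exact_mod_cast hb
  have hsum : ∀ q, ∑ u ∈ T, f u q =
      α * (∑ x ∈ Fintype.piFinset (fun _ : Fin 3 => Finset.Ico (0:ℤ) ((p:ℤ) * ((p:ℤ) * b))),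
          spinAt x q.1)
        - β * (∑ x ∈ Fintype.piFinset (fun _ : Fin 3 => Finset.Ico (0:ℤ) ((p:ℤ) * b)),
          spinAt x q.2) := by
    intro q
    have e1 := sum_subBoxes (L := (p:ℤ) * b) (by positivity) p (fun x => spinAt x q.1)
    have e2 := sum_subBoxes (L := (b:ℤ)) hb0 p (fun x => spinAt x q.2)
    simp only [hf]
    rw [Finset.sum_sub_distrib, ← Finset.mul_sum, ← Finset.mul_sum, e1, e2]
  -- Cauchy–Schwarz over the p³ positions
  have hTcard : (T.card : ℝ) = (p:ℝ) ^ 3 := by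
    have := hcardbox (p:ℤ) (fun _ => 0) hp0.le
    simp only [zero_add] at this
    rw [hT]; exact_mod_cast this
  have hCS := integral_sq_sum_le' (π := π) T f hfm B hfb
  have hsmall : ∫ q, (∑ u ∈ T, f u q) ^ 2 ∂π ≤ (p:ℝ) ^ 6 * C * (b:ℝ) ^ (-θ) := by
    refine hCS.trans ?_
    calc (T.card : ℝ) * ∑ u ∈ T, ∫ q, f u q ^ 2 ∂π
        ≤ (T.card : ℝ) * ∑ u ∈ T, C * (b : ℝ) ^ (-θ) :=
          mul_le_mul_of_nonneg_left (Finset.sum_le_sum hwin') (Nat.cast_nonneg _)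
      _ = (p:ℝ) ^ 6 * C * (b:ℝ) ^ (-θ) := by
          rw [Finset.sum_const, nsmul_eq_mul, hTcard]; ring
  -- the big-block difference, its norms under the marginals
  set X : SpinConfig (Site 3) × SpinConfig (Site 3) → ℝ := fun q =>
    α * ∑ x ∈ Fintype.piFinset (fun _ : Fin 3 => Finset.Ico (0:ℤ) ((p:ℤ) * ((p:ℤ) * b))),
      spinAt x q.1 with hX
  set Y : SpinConfig (Site 3) × SpinConfig (Site 3) → ℝ := fun q =>
    β * ∑ x ∈ Fintype.piFinset (fun _ : Fin 3 => Finset.Ico (0:ℤ) ((p:ℤ) * b)), spinAt x q.2 with hY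
  have hXm : Measurable X := ((hmeasS _).comp measurable_fst).const_mul α
  have hYm : Measurable Y := ((hmeasS _).comp measurable_snd).const_mul β
  obtain ⟨CX, hCX⟩ : ∃ CX : ℝ, ∀ q, |X q| ≤ CX := by
    refine ⟨α * (Fintype.piFinset (fun _ : Fin 3 => Finset.Ico (0:ℤ) ((p:ℤ) * ((p:ℤ) * b)))).card,
      fun q => ?_⟩
    simp only [hX]
    rw [abs_mul, abs_of_nonneg hα0]
    exact mul_le_mul_of_nonneg_left (hbd _ _) hα0
  obtain ⟨CY, hCY⟩ : ∃ CY : ℝ, ∀ q, |Y q| ≤ CY := by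
    refine ⟨β * (Fintype.piFinset (fun _ : Fin 3 => Finset.Ico (0:ℤ) ((p:ℤ) * b))).card,
      fun q => ?_⟩
    simp only [hY]
    rw [abs_mul, abs_of_nonneg hβ0]
    exact mul_le_mul_of_nonneg_left (hbd _ _) hβ0
  have hX2 : Integrable (fun q => X q ^ 2) π :=
    integrable_of_abs_le' (hXm.pow_const 2) (CX ^ 2) fun q => by
      rw [abs_pow]; exact pow_le_pow_left₀ (abs_nonneg _) (hCX q) 2
  have hY2 : Integrable (fun q => Y q ^ 2) π :=
    integrable_of_abs_le' (hYm.pow_const 2) (CY ^ 2) fun q => by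
      rw [abs_pow]; exact pow_le_pow_left₀ (abs_nonneg _) (hCY q) 2
  have hXY : Integrable (fun q => X q * Y q) π :=
    integrable_of_abs_le' (hXm.mul hYm) (CX * CY) fun q => by
      rw [abs_mul]
      exact mul_le_mul (hCX q) (hCY q) (abs_nonneg _) ((abs_nonneg _).trans (hCX q))
  have hlow := sq_sqrt_sub_sqrt_le hX2 hY2 hXY
  -- ∫ X² = α² A_{p²b},  ∫ Y² = β² A_{pb}  (marginals)
  have hXa : ∫ q, X q ^ 2 ∂π = α ^ 2 * ∫ σ, (∑ x ∈ Fintype.piFinset (fun _ : Fin 3 =>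
      Finset.Ico (0:ℤ) ((p:ℤ) * ((p:ℤ) * b))), spinAt x σ) ^ 2 ∂μ := by
    have : (fun q => X q ^ 2) = fun q => α ^ 2 * (fun σ : SpinConfig (Site 3) =>
        (∑ x ∈ Fintype.piFinset (fun _ : Fin 3 => Finset.Ico (0:ℤ) ((p:ℤ) * ((p:ℤ) * b))),
          spinAt x σ) ^ 2) q.1 := by
      funext q; rw [hX]; ring
    rw [this, integral_const_mul, ← hfst, Measure.fst, integral_map measurable_fst.aemeasurable
      ((hmeasS _).pow_const 2).aestronglyMeasurable]
  have hYa : ∫ q, Y q ^ 2 ∂π = β ^ 2 * Apb := by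
    have : (fun q => Y q ^ 2) = fun q => β ^ 2 * (fun σ : SpinConfig (Site 3) =>
        (∑ x ∈ Fintype.piFinset (fun _ : Fin 3 => Finset.Ico (0:ℤ) ((p:ℤ) * b)),
          spinAt x σ) ^ 2) q.2 := by
      funext q; rw [hY]; ring
    rw [this, integral_const_mul, hApb, ← hsnd, Measure.snd, integral_map measurable_snd.aemeasurable
      ((hmeasS _).pow_const 2).aestronglyMeasurable]
  -- assemble
  have hXY' : ∀ q, X q - Y q = ∑ u ∈ T, f u q := fun q => by rw [hsum q]
  have hmid : ∫ q, (X q - Y q) ^ 2 ∂π ≤ (p:ℝ) ^ 6 * C * (b:ℝ) ^ (-θ) := by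
    simp_rw [hXY']; exact hsmall
  have hsqX : Real.sqrt (∫ q, X q ^ 2 ∂π) = Real.sqrt (∫ σ, (∑ x ∈ Fintype.piFinset
      (fun _ : Fin 3 => Finset.Ico (0:ℤ) ((p:ℤ) * ((p:ℤ) * b))), spinAt x σ) ^ 2 ∂μ)
        / Real.sqrt Apb := by
    rw [hXa, Real.sqrt_mul' _ (integral_nonneg fun σ => sq_nonneg _), Real.sqrt_sq hα0, hα]
    ring
  have hsqY : Real.sqrt (∫ q, Y q ^ 2 ∂π) = Real.sqrt Apb / Real.sqrt Ab := by
    rw [hYa, Real.sqrt_mul' _ (integral_nonneg fun σ => sq_nonneg _), Real.sqrt_sq hβ0, hβ]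
    ring
  rw [hsqX, hsqY] at hlow
  calc _ ≤ ∫ q, (X q - Y q) ^ 2 ∂π := hlow
    _ ≤ (p:ℝ) ^ 6 * C * (b:ℝ) ^ (-θ) := hmid

end Summit.CriticalPhenomena.Ising3DConformalLimit.Cruxes.DilationJoinings.Sketch

end
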